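import Summits.AtomisticToContinuum.HydrodynamicLimit.Theses.ImplosionDichotomy
import Summits.AtomisticToContinuum.HydrodynamicLimit.Theorems.LambertianContactSwapLambertianEulerIterate
import Summits.AtomisticToContinuum.HydrodynamicLimit.Theorems.LambertianContactSwapLambertianEulerWindow
import Summits.AtomisticToContinuum.HydrodynamicLimit.Theorems.LambertianContactSwapLambertianEulerMarkov
import Summits.AtomisticToContinuum.HydrodynamicLimit.Theorems.LambertianContactSwapSwapGapRelEntBudget
import Summits.AtomisticToContinuum.HydrodynamicLimit.Theorems.LambertianContactSwapLambertianEulerEntropyBudget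
import Summits.AtomisticToContinuum.HydrodynamicLimit.Theorems.ImplosionDichotomyHydroLimitInBandEquilibrium
import Literature.MathematicalPhysics.KineticTheory.LambertianRedrawNondegenerate
import HarnessLib

/-!
# `SwapGap` (stmt-AtomisticToContinuum-11850), line `Sketch`: Λ-adiabaticity (S1a) from Euler for `Λ`, dilute self-consistency and static bookkeeping

Helper file (`--supports`) for the crux `…Theses.LambertianContactSwap.SwapGap`, line `Sketch` (entropy relative to the
Lambertian law), skeleton v3 (lead c2, cycle 3).  Notation: `P_N = localGibbsLaw σ a₀ u₀ θ₀ N (Φ N)` (local Gibbs data),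
`q_t = (Λ_t)_* (P_N ⊗ γ^ℕ)` (Lambertian law), `G_N = localGibbsLaw σ 1 0 1 N (Φ N)` (standard homogeneous Gibbs law).

c1's registered stub S1a `stub_lambdaAdiabaticity` — pre-shock, `KL(q_t ‖ G_N) < ∞` and
`[KL(P_N ‖ G_N) − KL(q_t ‖ G_N)]/(N+1) → 0` (the Lambertian gas started from local Gibbs data produces only `o(N)`
Gibbs–Shannon entropy before the first shock) — is proved here (`lambdaAdiabaticity_of`) from three hypotheses that are
the v3 skeleton's registered stubs:
* `LambertianEuler` in its named-API form (the sibling crux stmt-AtomisticToContinuum-11854; the skeleton derives it from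
  the exponential-rate stub `stub_lambertianEulerLD`),
* `ImplosionDichotomy.DiluteSelfConsistency` (stmt-AtomisticToContinuum-3091: the Euler density stays in the dilute window),
* STATIC BOOKKEEPING (`stub_staticBookkeeping`, Λ-free and Φ-free): in the dilute window, every family of probability laws
  `μ_N` with (i) `KL(μ_N ‖ G_N) ≤ KL(P_N ‖ G_N)`, (ii) the same kinetic-energy law as `P_N` and (iii) empirical fields
  converging in probability to the Euler values at time `t` satisfies `[KL(P_N ‖ G_N) − KL(μ_N ‖ G_N)]/(N+1) → 0`.
The glue checks (i)–(iii) for `μ_N := q_t`: (i) is data processing through the independent redraws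
(`klDiv_lambertFlow_le`) because `G_N ⊗ γ^ℕ` is `Λ_t`-invariant (`stub_gibbsInvariance` fed with the landed
`Λ`-Liouville invariance, p116909, re-derived privately here); (ii) holds because `E ∘ Λ_t = E` for every datum and
a.e. noise (`ae_lambertNoise_forall_configEnergy_lambertFlow_hsDiameter`); (iii) is `LambertianEuler` read through
`Measure.map_apply`; finiteness is conjunct 2 of `klDiv_map_flow_map_lambertFlow_decomposition` (unconditional since S0 landed).
prover-line-stmt-AtomisticToContinuum-11850-c2-0.
-/

noncomputable section

open MeasureTheory Filter Set Topology InformationTheory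
open scoped ENNReal

namespace Summit.AtomisticToContinuum.HydrodynamicLimit.Theorems.LambertianContactSwapSwapGapLambdaAdiabaticity

open Literature.Analysis.FluidPDE Literature.MathematicalPhysics.KineticTheory
open Summit.AtomisticToContinuum.HydrodynamicLimit.Theorems
open Summit.AtomisticToContinuum.HydrodynamicLimit.Theorems.LambertianContactSwapSwapGapRelEntBudget
open Summit.AtomisticToContinuum.HydrodynamicLimit.Theorems.LambertianContactSwapLambertianEulerGibbsInvariance
open Summit.AtomisticToContinuum.HydrodynamicLimit.Theorems.LambertianContactSwapLambertianEulerEntropyBudget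
open Summit.AtomisticToContinuum.HydrodynamicLimit.Theorems.LambertianContactSwapLambertianEulerWindow
open Summit.AtomisticToContinuum.HydrodynamicLimit.Theorems.LambertianContactSwapLambertianEulerMarkov
open Summit.AtomisticToContinuum.HydrodynamicLimit.Theorems.LambertianContactSwapLambertianEulerIterate

/-- The `Λ`-invariance of `liouville ⊗ γ^ℕ` (registered stub S0; landed as
`…SwapGapLiouvilleInvarianceLambda.stub_liouvilleInvarianceLambda`, p116909 — re-derived privately from the sibling
line's ITERATE/WINDOW/MARKOV so that this file does not wait for that olean). [cite: GST2013, Prop. 4.1.1] -/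
private theorem liouvilleInvarianceLambda :
    ∀ ε : ℝ, 0 < ε → ε < 2⁻¹ → ∀ (N : ℕ) (t : ℝ), 0 ≤ t →
      ((liouville (Torus.geometry (Fin 3)) N ε).prod (lambertNoise (Fin 3))).map
          (fun p => lambertFlow (Torus.geometry (Fin 3)) ε p.2 p.1 t) =
        liouville (Torus.geometry (Fin 3)) N ε :=
  fun _ hε hε' _ t ht =>
    (stub_iterateLambda hε hε' (fun hV hδ hr hch => stub_windowLambda hε hV hδ hr hch)
      (fun z s hs _ r hr _ hQ _ hH => stub_markovLambda hε hε' z s hs r hr hQ hH)).1 t ht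

/-- **Λ-ADIABATICITY PRE-SHOCK from `LambertianEuler`, dilute self-consistency and static bookkeeping**
(c1's registered stub `stub_lambdaAdiabaticity`, verbatim signature, now a theorem modulo the three stubs):
with `σ₀ := min (1/2, σ_B, σ_D(η₀), σ_E)`, for `σ < σ₀` and `t ∈ [0, T)`, `KL(q_t ‖ G_N) < ∞` for every `N`
(`klDiv_map_flow_map_lambertFlow_decomposition`, unconditional since S0 landed) and the bookkeeping applies to
`μ_N := q_t`: (i) `KL(q_t ‖ G_N) ≤ KL(P_N ‖ G_N)` is data processing through the independent redraws
(`klDiv_lambertFlow_le`) since `G_N ⊗ γ^ℕ` is `Λ_t`-invariant (`stub_gibbsInvariance` fed with S0); (ii) the law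
of the kinetic energy under `q_t` is its law under `P_N` because `E ∘ Λ_t = E` for every datum and a.e. noise
(`ae_lambertNoise_forall_configEnergy_lambertFlow_hsDiameter`); (iii) the field deviation events under `q_t`
are the `Λ_t`-preimages of `LambertianEuler`'s events (`Measure.map_apply`). [cite: KipnisLandim1999, Ch. 6 §1] -/
theorem lambdaAdiabaticity_of
    (hLE : ∀ (a₀ θ₀ : T3 → ℝ) (u₀ : T3 → V3), Continuous a₀ → Continuous θ₀ → Continuous u₀ →
      (∀ x, 0 < a₀ x) → (∀ x, 0 < θ₀ x) →
      ∃ σ₀ : ℝ, 0 < σ₀ ∧ ∀ σ : ℝ, 0 < σ → σ < σ₀ →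
        ∀ (T : ℝ) (ρ θ : ℝ → T3 → ℝ) (u : ℝ → T3 → V3), IsHardSphereEulerSolution σ T ρ u θ →
          ∀ Φ : (N : ℕ) → HardSphereFlow (Torus.geometry (Fin 3)) (hsDiameter σ N) (N + 1),
            TendstoHydroFieldsAt (fun N => localGibbsLaw σ a₀ u₀ θ₀ N (Φ N)) Φ ρ u θ 0 →
              ∀ t ∈ Set.Ico 0 T, ∀ χ : T3 → ℝ, Continuous χ → ∀ δ > (0 : ℝ),
                Tendsto (fun N : ℕ => ((localGibbsLaw σ a₀ u₀ θ₀ N (Φ N)).prod (lambertNoise (Fin 3)))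
                  {p | δ < |empiricalDensityField
                    (lambertFlow (Torus.geometry (Fin 3)) (hsDiameter σ N) p.2 p.1 t) χ -
                      ∫ x, χ x * ρ t x|}) atTop (nhds 0) ∧
                Tendsto (fun N : ℕ => ((localGibbsLaw σ a₀ u₀ θ₀ N (Φ N)).prod (lambertNoise (Fin 3)))
                  {p | δ < ‖empiricalMomentumField
                    (lambertFlow (Torus.geometry (Fin 3)) (hsDiameter σ N) p.2 p.1 t) χ -
                      ∫ x, (χ x * ρ t x) • u t x‖}) atTop (nhds 0) ∧
                Tendsto (fun N : ℕ => ((localGibbsLaw σ a₀ u₀ θ₀ N (Φ N)).prod (lambertNoise (Fin 3)))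
                  {p | δ < |empiricalEnergyField
                    (lambertFlow (Torus.geometry (Fin 3)) (hsDiameter σ N) p.2 p.1 t) χ -
                      ∫ x, χ x * totalEnergyDensity (ρ t x) (u t x) (θ t x)|}) atTop (nhds 0))
    (hDSC : Summit.AtomisticToContinuum.HydrodynamicLimit.Theses.ImplosionDichotomy.DiluteSelfConsistency)
    (hBK : ∀ (a₀ θ₀ : T3 → ℝ) (u₀ : T3 → V3), Continuous a₀ → Continuous θ₀ → Continuous u₀ →
      (∀ x, 0 < a₀ x) → (∀ x, 0 < θ₀ x) →
      ∃ η₀ : ℝ, 0 < η₀ ∧ ∃ σ₀ : ℝ, 0 < σ₀ ∧ ∀ σ : ℝ, 0 < σ → σ < σ₀ →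
        ∀ (T : ℝ) (ρ θ : ℝ → T3 → ℝ) (u : ℝ → T3 → V3), IsHardSphereEulerSolution σ T ρ u θ →
          (∀ t ∈ Set.Ico 0 T, ∀ x, ρ t x * σ ^ 3 < η₀) →
          ∀ Φ : (N : ℕ) → HardSphereFlow (Torus.geometry (Fin 3)) (hsDiameter σ N) (N + 1),
            TendstoHydroFieldsAt (fun N => localGibbsLaw σ a₀ u₀ θ₀ N (Φ N)) Φ ρ u θ 0 →
              ∀ t ∈ Set.Ico 0 T, ∀ μ : (N : ℕ) → Measure (Config (N + 1) (Fin 3) T3),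
                (∀ N, IsProbabilityMeasure (μ N)) →
                (∀ N, klDiv (μ N) (localGibbsLaw σ (fun _ => 1) (fun _ => 0) (fun _ => 1) N (Φ N)) ≤
                  klDiv (localGibbsLaw σ a₀ u₀ θ₀ N (Φ N))
                    (localGibbsLaw σ (fun _ => 1) (fun _ => 0) (fun _ => 1) N (Φ N))) →
                (∀ N, (μ N).map configEnergy = (localGibbsLaw σ a₀ u₀ θ₀ N (Φ N)).map configEnergy) →
                (∀ χ : T3 → ℝ, Continuous χ → ∀ δ : ℝ, 0 < δ →
                  Tendsto (fun N => μ N {z | δ < |empiricalDensityField z χ - ∫ x, χ x * ρ t x|})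
                    atTop (𝓝 0) ∧
                  Tendsto (fun N => μ N {z | δ < ‖empiricalMomentumField z χ -
                    ∫ x, (χ x * ρ t x) • u t x‖}) atTop (𝓝 0) ∧
                  Tendsto (fun N => μ N {z | δ < |empiricalEnergyField z χ -
                    ∫ x, χ x * totalEnergyDensity (ρ t x) (u t x) (θ t x)|}) atTop (𝓝 0)) →
                Tendsto (fun N : ℕ =>
                  ((klDiv (localGibbsLaw σ a₀ u₀ θ₀ N (Φ N))
                      (localGibbsLaw σ (fun _ => 1) (fun _ => 0) (fun _ => 1) N (Φ N))).toReal -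
                    (klDiv (μ N) (localGibbsLaw σ (fun _ => 1) (fun _ => 0) (fun _ => 1) N (Φ N))).toReal) /
                  ((N : ℝ) + 1)) atTop (𝓝 0)) :
    ∀ (a₀ θ₀ : T3 → ℝ) (u₀ : T3 → V3), Continuous a₀ → Continuous θ₀ → Continuous u₀ →
      (∀ x, 0 < a₀ x) → (∀ x, 0 < θ₀ x) →
      ∃ σ₀ : ℝ, 0 < σ₀ ∧ ∀ σ : ℝ, 0 < σ → σ < σ₀ →
        ∀ (T : ℝ) (ρ θ : ℝ → T3 → ℝ) (u : ℝ → T3 → V3), IsHardSphereEulerSolution σ T ρ u θ →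
          ∀ Φ : (N : ℕ) → HardSphereFlow (Torus.geometry (Fin 3)) (hsDiameter σ N) (N + 1),
            TendstoHydroFieldsAt (fun N => localGibbsLaw σ a₀ u₀ θ₀ N (Φ N)) Φ ρ u θ 0 →
              ∀ t ∈ Set.Ico 0 T,
                (∀ N : ℕ, klDiv (((localGibbsLaw σ a₀ u₀ θ₀ N (Φ N)).prod (lambertNoise (Fin 3))).map
                    (fun p => lambertFlow (Torus.geometry (Fin 3)) (hsDiameter σ N) p.2 p.1 t))
                  (localGibbsLaw σ (fun _ => 1) (fun _ => 0) (fun _ => 1) N (Φ N)) ≠ ∞) ∧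
                Tendsto (fun N : ℕ =>
                  ((klDiv (localGibbsLaw σ a₀ u₀ θ₀ N (Φ N))
                      (localGibbsLaw σ (fun _ => 1) (fun _ => 0) (fun _ => 1) N (Φ N))).toReal -
                    (klDiv (((localGibbsLaw σ a₀ u₀ θ₀ N (Φ N)).prod (lambertNoise (Fin 3))).map
                        (fun p => lambertFlow (Torus.geometry (Fin 3)) (hsDiameter σ N) p.2 p.1 t))
                      (localGibbsLaw σ (fun _ => 1) (fun _ => 0) (fun _ => 1) N (Φ N))).toReal) /
                  ((N : ℝ) + 1)) atTop (𝓝 0) := by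
  intro a₀ θ₀ u₀ ha hθ hu ha0 hθ0
  obtain ⟨η₀, hη₀, σ₁, hσ₁, hB⟩ := hBK a₀ θ₀ u₀ ha hθ hu ha0 hθ0
  obtain ⟨σ₂, hσ₂, hD⟩ := hDSC η₀ hη₀ a₀ θ₀ u₀ ha hθ hu ha0 hθ0
  obtain ⟨σ₃, hσ₃, hL⟩ := hLE a₀ θ₀ u₀ ha hθ hu ha0 hθ0
  refine ⟨min 2⁻¹ (min σ₁ (min σ₂ σ₃)),
    lt_min (by norm_num) (lt_min hσ₁ (lt_min hσ₂ hσ₃)), ?_⟩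
  intro σ hσ hσlt T ρ θ u hE Φ h0 t ht
  have hσhalf : σ < 2⁻¹ := hσlt.trans_le (min_le_left _ _)
  have hσ₁' : σ < σ₁ := hσlt.trans_le ((min_le_right _ _).trans (min_le_left _ _))
  have hσ₂' : σ < σ₂ :=
    hσlt.trans_le ((min_le_right _ _).trans ((min_le_right _ _).trans (min_le_left _ _)))
  have hσ₃' : σ < σ₃ :=
    hσlt.trans_le ((min_le_right _ _).trans ((min_le_right _ _).trans (min_le_right _ _)))
  have hσ2 : σ ≤ 1 / 2 := by rw [one_div]; exact hσhalf.le
  -- the laws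
  set P : (N : ℕ) → Measure (Config (N + 1) (Fin 3) T3) := fun N => localGibbsLaw σ a₀ u₀ θ₀ N (Φ N)
    with hPdef
  set Gr : (N : ℕ) → Measure (Config (N + 1) (Fin 3) T3) :=
    fun N => localGibbsLaw σ (fun _ => (1 : ℝ)) (fun _ => (0 : V3)) (fun _ => (1 : ℝ)) N (Φ N) with hGdef
  have hΛ : ∀ N, Measurable fun p : Config (N + 1) (Fin 3) T3 × (ℕ → V3) =>
      lambertFlow (Torus.geometry (Fin 3)) (hsDiameter σ N) p.2 p.1 t :=
    fun N => measurable_lambertFlow_hsDiameter hσ.le hσhalf N t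
  set q : (N : ℕ) → Measure (Config (N + 1) (Fin 3) T3) := fun N =>
    ((P N).prod (lambertNoise (Fin 3))).map
      (fun p => lambertFlow (Torus.geometry (Fin 3)) (hsDiameter σ N) p.2 p.1 t) with hqdef
  have hPN : ∀ N, IsProbabilityMeasure (P N) := fun N =>
    isProbabilityMeasure_localGibbsLaw ha hθ hu ha0 hθ0 hσ2 N (Φ N)
  have hGN : ∀ N, IsProbabilityMeasure (Gr N) := fun N =>
    isProbabilityMeasure_localGibbsLaw (a₀ := fun _ => (1 : ℝ)) (θ₀ := fun _ => (1 : ℝ))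
      (u₀ := fun _ => (0 : V3)) continuous_const continuous_const continuous_const
      (fun _ => one_pos) (fun _ => one_pos) hσ2 N (Φ N)
  have hqN : ∀ N, IsProbabilityMeasure (q N) := fun N => by
    haveI := hPN N
    exact Measure.isProbabilityMeasure_map (hΛ N).aemeasurable
  -- finiteness of `KL(q_t ‖ G_N)` (S0 is a theorem)
  obtain ⟨A, b, -, -, hdec⟩ := klDiv_map_flow_map_lambertFlow_decomposition
    liouvilleInvarianceLambda ha hθ hu ha0 hθ0 hσ hσhalf
  have hfin : ∀ N : ℕ, klDiv (q N) (Gr N) ≠ ∞ := fun N => (hdec N (Φ N) t ht.1).2.1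
  refine ⟨hfin, ?_⟩
  -- the three bookkeeping hypotheses for `μ := q`
  have h2 : ∀ N, klDiv (q N) (Gr N) ≤ klDiv (P N) (Gr N) := by
    intro N
    haveI := hPN N
    haveI := hGN N
    exact klDiv_lambertFlow_le σ N t (P N) (Gr N) (hΛ N)
      (stub_gibbsInvariance liouvilleInvarianceLambda σ hσ hσhalf N 1 1 0 one_pos one_pos
        (Φ N) t ht.1)
  have h3 : ∀ N, (q N).map configEnergy = (P N).map configEnergy := by
    intro N
    haveI := hPN N
    have hEm : Measurable (configEnergy : Config (N + 1) (Fin 3) T3 → ℝ) := by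
      unfold configEnergy
      exact measurable_const.mul
        (Finset.measurable_sum _ fun i _ => ((measurable_pi_apply i).snd).norm.pow_const 2)
    have hEΛ : (fun p : Config (N + 1) (Fin 3) T3 × (ℕ → V3) =>
        configEnergy (lambertFlow (Torus.geometry (Fin 3)) (hsDiameter σ N) p.2 p.1 t)) =ᵐ[
          (P N).prod (lambertNoise (Fin 3))] fun p => configEnergy p.1 := by
      refine (Measure.ae_prod_iff_ae_ae ?_).2 (ae_of_all _ fun z =>
        (ae_lambertNoise_forall_configEnergy_lambertFlow_hsDiameter hσ.le hσhalf N z).mono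
          fun ξs h => h t)
      exact measurableSet_eq_fun (hEm.comp (hΛ N)) (hEm.comp measurable_fst)
    rw [hqdef]
    dsimp only
    rw [Measure.map_map hEm (hΛ N), show (configEnergy ∘ fun p : Config (N + 1) (Fin 3) T3 × (ℕ → V3) =>
        lambertFlow (Torus.geometry (Fin 3)) (hsDiameter σ N) p.2 p.1 t) =
        fun p => configEnergy (lambertFlow (Torus.geometry (Fin 3)) (hsDiameter σ N) p.2 p.1 t) from rfl,
      Measure.map_congr hEΛ,
      show (fun p : Config (N + 1) (Fin 3) T3 × (ℕ → V3) => configEnergy p.1) = configEnergy ∘ Prod.fst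
        from rfl,
      ← Measure.map_map hEm measurable_fst, Measure.map_fst_prod, measure_univ, one_smul]
  have h4 : ∀ χ : T3 → ℝ, Continuous χ → ∀ δ : ℝ, 0 < δ →
      Tendsto (fun N => q N {z | δ < |empiricalDensityField z χ - ∫ x, χ x * ρ t x|}) atTop (𝓝 0) ∧
      Tendsto (fun N => q N {z | δ < ‖empiricalMomentumField z χ - ∫ x, (χ x * ρ t x) • u t x‖})
        atTop (𝓝 0) ∧
      Tendsto (fun N => q N {z | δ < |empiricalEnergyField z χ -
        ∫ x, χ x * totalEnergyDensity (ρ t x) (u t x) (θ t x)|}) atTop (𝓝 0) := by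
    intro χ hχ δ hδ
    obtain ⟨hd, hm, he⟩ := hL σ hσ hσ₃' T ρ θ u hE Φ h0 t ht χ hχ δ hδ
    refine ⟨hd.congr fun N => ?_, hm.congr fun N => ?_, he.congr fun N => ?_⟩
    · rw [hqdef]
      dsimp only
      rw [Measure.map_apply (hΛ N)]
      · rfl
      · exact measurableSet_lt measurable_const
          ((measurable_empiricalDensityField hχ).sub measurable_const).abs
    · rw [hqdef]
      dsimp only
      rw [Measure.map_apply (hΛ N)]
      · rfl
      · exact measurableSet_lt measurable_const
          ((measurable_empiricalMomentumField hχ).sub measurable_const).norm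
    · rw [hqdef]
      dsimp only
      rw [Measure.map_apply (hΛ N)]
      · rfl
      · exact measurableSet_lt measurable_const
          ((measurable_empiricalEnergyField hχ).sub measurable_const).abs
  exact hB σ hσ hσ₁' T ρ θ u hE (hD σ hσ hσ₂' T ρ θ u hE Φ h0) Φ h0 t ht q hqN h2 h3 h4


end Summit.AtomisticToContinuum.HydrodynamicLimit.Theorems.LambertianContactSwapSwapGapLambdaAdiabaticity

end
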